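import Mathlib
import Summits.NavierStokesRegularity.NavierStokesRegularity.Theorems.TypeILiouvilleLatticeLiouville
import Summits.NavierStokesRegularity.NavierStokesRegularity.Theorems.TypeILiouvilleTypeIliouvilleLOseenGauge

/-!
# TypeILiouvilleLatticeCrux — crux (L) stmt-NavierStokesRegularity-10661 `TypeIliouvilleL`
# ON ITS OWN CLASS: (L) HOLDS for members with a.e. `ℤ³`-periodic slices

Helper for stmt-NavierStokesRegularity-10661 (`--supports`); theorems only, no definitions, no named-fact
hypotheses; closes no item; Navier–Stokes regularity is NOT proved here (leafhand seat of the
EulerZoomLiouville route, LAND-ONLY).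

The crux (L) = `Theses.TypeILiouville.TypeIliouvilleL` = `Literature.Analysis.FluidPDE.LiouvilleConjectureNS`
quantifies over the duality-form class `IsBoundedAncientMildSolution 1 u` with a.e.-strongly measurable slices and
concludes `u t =ᵐ const` on every slice.  Here the crux is PROVED on the stratum of members whose slices are
a.e. invariant under the three unit translations:

* `liouvilleL_onLatticePeriodic` — hypotheses of the crux VERBATIM plus
  `∀ t < 0, ∀ j, (fun x => u t (x + e_j)) =ᵐ u t` ⟹ `∀ t < 0, ∃ b, u t =ᵐ fun _ => b`.
  Proof: the landed Oseen gauge `Theorems.oseen_gauge_of_aestronglyMeasurable` writes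
  `u t =ᵐ v t (· − A t) + c t` with `v` in print's class P; a.e. periodicity passes to `v t` through the
  measure-preserving translations and becomes pointwise by continuity; the periodic sieve
  `TypeILiouvilleLatticeMomentum.classP_const_of_isLatticePeriodic` makes `v` one constant vector.

[cite: KochNadirashviliSereginSverak2009, §1 conjecture (L), §4 p. 8 (arXiv:0709.3599)]
-/

noncomputable section
open MeasureTheory Filter Set Function Metric
open scoped Topology
open Literature.Analysis Literature.Analysis.FunctionSpaces Literature.Analysis.FluidPDE
set_option linter.dupNamespace false
namespace Summit.NavierStokesRegularity.NavierStokesRegularity.Theorems.TypeILiouvilleLatticeMomentum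

/-- **(L) on the lattice-periodic stratum of its own class.**  Every bounded ancient mild solution (`ν = 1`,
duality form) with a.e.-strongly measurable slices, each of which is a.e. invariant under the unit
translations `x ↦ x + e_j` (`j = 0,1,2`), is a.e. equal to a constant vector on every slice `t < 0` — the
conclusion of `Theses.TypeILiouville.TypeIliouvilleL` for these members. [cite: KochNadirashviliSereginSverak2009, §1 conjecture (L) and §4 p. 8 (arXiv:0709.3599)] -/
theorem liouvilleL_onLatticePeriodic
    (u : ℝ → EuclideanSpace ℝ (Fin 3) → EuclideanSpace ℝ (Fin 3))
    (hu : IsBoundedAncientMildSolution 1 u)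
    (hmeas : ∀ t < 0, AEStronglyMeasurable (u t) volume)
    (hper : ∀ t < 0, ∀ j : Fin 3,
      (fun x => u t (x + EuclideanSpace.single j 1)) =ᵐ[volume] u t) :
    ∀ t < 0, ∃ b : EuclideanSpace ℝ (Fin 3), u t =ᵐ[volume] fun _ => b := by
  obtain ⟨v, A, c, -, hvc, hvK, hvd, hvm, -, hrep⟩ :=
    Theorems.oseen_gauge_of_aestronglyMeasurable u hu hmeas
  have hslice : ∀ τ < 0, Continuous (v τ) := fun τ hτ =>
    hvc.comp_continuous (f := fun x : EuclideanSpace ℝ (Fin 3) => (τ, x)) (by fun_prop)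
      fun x => ⟨hτ, mem_univ _⟩
  -- a.e. periodicity of `u t` passes to `v t`, pointwise by continuity
  have hvper : ∀ t < 0, Torus.IsLatticePeriodic (v t) := by
    intro t ht j y
    set e : EuclideanSpace ℝ (Fin 3) := EuclideanSpace.single j 1 with he
    -- `u t (x + e) = v t (x + e - A t) + c t` a.e. (translate the gauge by `e`)
    have h1 : (fun x => u t (x + e)) =ᵐ[volume] fun x => v t (x + e - A t) + c t :=
      (hrep t ht).comp_tendsto (measurePreserving_add_right volume e).quasiMeasurePreserving.tendsto_ae
    -- hence `v t (x + e - A t) = v t (x - A t)` a.e.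
    have h2 : (fun x => v t (x + e - A t)) =ᵐ[volume] fun x => v t (x - A t) := by
      filter_upwards [h1, hper t ht j, hrep t ht] with x hx1 hx2 hx3
      have h4 : v t (x + e - A t) + c t = v t (x - A t) + c t := by rw [← hx1, hx2, hx3]
      exact add_right_cancel h4
    -- translate back by `A t`
    have h3 : (fun x => v t (x + e)) =ᵐ[volume] fun x => v t x := by
      have h5 := h2.comp_tendsto
        (measurePreserving_add_right volume (A t)).quasiMeasurePreserving.tendsto_ae
      refine h5.mono fun x hx => ?_
      simp only [Function.comp_apply, add_sub_cancel_right] at hx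
      rwa [add_right_comm, add_sub_cancel_right] at hx
    have hcont1 : Continuous fun x => v t (x + e) := (hslice t ht).comp (continuous_id.add continuous_const)
    have heq : (fun x => v t (x + e)) = v t :=
      (Continuous.ae_eq_iff_eq volume hcont1 (hslice t ht)).1 h3
    exact congr_fun heq y
  -- the periodic sieve on print's class
  obtain ⟨b, hb⟩ := classP_const_of_isLatticePeriodic hvc hvK hvd hvm hvper
  intro t ht
  refine ⟨b + c t, ?_⟩
  filter_upwards [hrep t ht] with x hx
  rw [hx, hb t ht]

end Summit.NavierStokesRegularity.NavierStokesRegularity.Theorems.TypeILiouvilleLatticeMomentum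

end
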